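import Summits.HodgeConjecture.HodgeConjecture.Theorems.Ring2AbelianAllAndrePrimitiveLiftFibreLefschetzDegree
import HarnessLib

/-!
# Ring 2 · sub-cell AbelianAll (ALL ABELIAN VARIETIES), André axis, part XXIII-g — rows of part XXIII-f: the fibre clause discharged; W₆ with
# rank-one `H⁴`-invariants from the fibre-supported clause; the `E`-power Weil row

HONEST FRAMING (page 1, verbatim): **research route, not a corollary; conditional on HC_CM plus one named
minimal statement.** Cell line: research route conditional on HC_CM; not a corollary; Q11.4-sentence-2
already refuted in dim ≥ 3. Nothing in this file proves a case of the Hodge conjecture for an abelian variety; `HC_CM` does not occur in this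
file (IDLE on the `E`-power row); item `Theses.RankFourFaces.CMToAbelian` (stmt-16267) OPEN and not closed here; `(W_E)₃`
(`CMPowerAnchoredCompactWeilPencilsAt 3`, part IX) is an OPEN habitat node used as a hypothesis. Seat `pub-hodge-ring2-ab-andre-2`, gen 15.

## What is proved (theorems only; no definition, no named fact, no sorry)

**`primitiveLift_succ_of_fibreLefschetzDegree'`** ((Prim)_t(p+1) ⟸ (L)_t(p) ∧ [fibre-supported clause]; Kleiman's clause of the abelian fibre
discharged by Lieberman, part XXII-d); **`forall_comap_le_sup_of_rankOne_of_fibreLefschetzDegree_three`** (W₆: on a compact pencil of abelian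
SIXFOLDS with rank-one `H⁴`-invariants at `t`, the André-axis lift in every degree at `t` ⟸ for every `κ`-PRIMITIVE invariant algebraic
`ξ ∈ H⁶(X_t)`, `j_{t*}ξ = K ∪ x` with `x ∈ N³(𝒳⁷)` algebraic — "the Weil 3-cycles of the fibre are homologically hyperplane sections of algebraic
4-cycles of the sevenfold"); **`weilSixfolds_of_cmPowerWeilPencilsAt_of_rankOne_of_fibreLefschetzDegree_three`** (`(W_E)₃ ∧ [that, at the `E`-power
points of the compact sextic pencils, for every Kähler–rational datum] ⟹ WeilSixfolds`; K; `HC_CM` idle). Honest status as in part XXIII-f: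
implied by `A₃(𝒳, K)`, not known from `HC_AV`, not equivalent to the lift, nothing minimal, no node.

References: Grothendieck1968 (§3 p. 196); Lieberman1968 (Thm. 1); vanGeemen1994HodgeAV (Thm. 4.3, 5.12, 6.12); Andre1996Motifs (§6.3, Lemme 6.3.3).
-/

noncomputable section

set_option linter.dupNamespace false

namespace Summit.HodgeConjecture.HodgeConjecture.Ring2.AbelianAll

open CategoryTheory AlgebraicGeometry
open Literature.AlgebraicGeometry Literature.AlgebraicGeometry.Motives
open Literature.AlgebraicGeometry.HodgeTheory
open Literature.AlgebraicTopology.SingularHomology (singularCohomology cupProduct cupProduct_map)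
open Literature.Geometry.Kaehler (lefschetzOperator lefschetzPow HasHardLefschetzProperty)

/-! ## §3 Consequences: the fibre clause discharged; W₆ with rank-one `H⁴`-invariants; the `E`-power Weil row -/

section Rows

open Summit.HodgeConjecture.HodgeConjecture.Theses
open Summit.HodgeConjecture.HodgeConjecture.Ring2.Hypotheses (cmPowerLocus)

variable {𝒳 S : SchemeOver ℂ} {d : ℕ} {f : 𝒳 ⟶ S}

/-- **(Prim)_t(p+1) ⟸ (L)_t(p) ∧ [fibre-supported clause], the clause of the abelian fibre discharged by Lieberman** (part XXII-d
`standardConjectureA_fiberOver`). [cite: Lieberman1968, main theorem] [cite: Grothendieck1968, §3 p. 196 (A(X))] -/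
theorem primitiveLift_succ_of_fibreLefschetzDegree' (hf : IsCompactAbelianPencil f d) (t : ComplexPoints S)
    (D : KaehlerRationalDatum (d + 1) 𝒳)
    (hK : ∀ s : ComplexPoints S, HasHardLefschetzProperty (complexBetti.map (fiberι f s) 2 D.Hη) d)
    (hKt : IsPolarizationClass d (fiberOver f t) (complexBetti.map (fiberι f t) 2 D.Hη)) {p m : ℕ}
    (hpm : 2 * (p + 1) + m = d)
    (hprev : (algebraicClasses (fiberOver f t) p).comap (complexBetti.map (fiberι f t) (2 * p)).hom ≤
      algebraicClasses 𝒳 p ⊔ LinearMap.ker (complexBetti.map (fiberι f t) (2 * p)).hom)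
    (hAfib : ∀ ξ ∈ algebraicClasses (fiberOver f t) (p + 1),
      ξ ∈ primitiveClasses (complexBetti.map (fiberι f t) 2 D.Hη) d (2 * (p + 1)) →
      ξ ∈ LinearMap.range (complexBetti.map (fiberι f t) (2 * (p + 1))).hom →
      ∃ x ∈ algebraicClasses 𝒳 (p + 1),
        lefschetzPowTo D.Hη (m + 1) (2 * (p + 1)) (2 * (p + 1 + m + 1)) (by omega) x =
          fiberGysin hf t (p + 1 + m)
            (lefschetzPowTo (complexBetti.map (fiberι f t) 2 D.Hη) m (2 * (p + 1)) (2 * (p + 1 + m)) (by omega) ξ)) :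
    ∀ ξ ∈ algebraicClasses (fiberOver f t) (p + 1),
      ξ ∈ primitiveClasses (complexBetti.map (fiberι f t) 2 D.Hη) d (2 * (p + 1)) →
      ξ ∈ LinearMap.range (complexBetti.map (fiberι f t) (2 * (p + 1))).hom →
      ξ ∈ (algebraicClasses 𝒳 (p + 1)).map (complexBetti.map (fiberι f t) (2 * (p + 1))).hom :=
  primitiveLift_succ_of_fibreLefschetzDegree hf t D hK hKt hpm
    (fun p' r' q' _ _ h1 h2 ↦ ((standardConjectureA_fiberOver hf t hKt).2 p' r' q' h1 h2).surjOn) hprev hAfib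

/-- **W₆, SHARPEST FORM: rank-one `H⁴`-invariants at `t` and, for each `κ`-PRIMITIVE invariant algebraic class `ξ ∈ H⁶(X_t)` (at an
`E`-power or CM fibre of a large-monodromy Weil-type pencil: the primitive projections of the Weil classes, nothing else), the codimension-`4`
algebraic class `j_{t*}ξ` of the SEVENFOLD is `K ∪ x` with `x ∈ N³(𝒳)` ALGEBRAIC ⟹ the André-axis lift in every degree at `t`.** The
find-the-cycle problem of RING2-MAP AA2.102/AA2.107 becomes: the Weil 3-cycles of the fibre, viewed in the sevenfold total space, are homologically
hyperplane sections `K · Y` of algebraic 4-cycles `Y` of `𝒳`. No `HC_CM`, no named fact. [cite: Grothendieck1968, §3 p. 196 (A(X))]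
[cite: vanGeemen1994HodgeAV, Thm. 6.12] [cite: Andre1996Motifs, §6.3 (p. 33)] -/
theorem forall_comap_le_sup_of_rankOne_of_fibreLefschetzDegree_three {f : 𝒳 ⟶ S} (hf : IsCompactAbelianPencil f 6)
    (t : ComplexPoints S) (D : KaehlerRationalDatum (6 + 1) 𝒳)
    (hK : ∀ s : ComplexPoints S, HasHardLefschetzProperty (complexBetti.map (fiberι f s) 2 D.Hη) 6)
    (hKt : IsPolarizationClass 6 (fiberOver f t) (complexBetti.map (fiberι f t) 2 D.Hη))
    (h1 : Module.finrank ℂ (LinearMap.range (complexBetti.map (fiberι f t) (2 * 2)).hom) = 1)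
    (hA3 : ∀ ξ ∈ algebraicClasses (fiberOver f t) 3,
      ξ ∈ primitiveClasses (complexBetti.map (fiberι f t) 2 D.Hη) 6 (2 * 3) →
      ξ ∈ LinearMap.range (complexBetti.map (fiberι f t) (2 * 3)).hom →
      ∃ x ∈ algebraicClasses 𝒳 3, lefschetzPowTo D.Hη 1 (2 * 3) (2 * 4) (by omega) x = fiberGysin hf t 3 ξ) :
    ∀ p : ℕ, (algebraicClasses (fiberOver f t) p).comap (complexBetti.map (fiberι f t) (2 * p)).hom ≤
      algebraicClasses 𝒳 p ⊔ LinearMap.ker (complexBetti.map (fiberι f t) (2 * p)).hom := by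
  have hKalg : D.Hη ∈ algebraicClasses 𝒳 1 := (isPolarizationClass_Hη hf.isSmoothProjective_total D).mem_algebraicClasses
  have h2 : (algebraicClasses (fiberOver f t) 2).comap (complexBetti.map (fiberι f t) (2 * 2)).hom ≤
      algebraicClasses 𝒳 2 ⊔ LinearMap.ker (complexBetti.map (fiberι f t) (2 * 2)).hom :=
    (comap_le_sup_two_iff_primitiveLift_two hf t hKalg hK hKt).2 (primitiveLift_two_of_finrank_range_four_eq_one hf t hK h1)
  refine (forall_comap_le_sup_iff_primitiveLift_three_of_rankOne hf t hKalg hK hKt h1).2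
    (primitiveLift_succ_of_fibreLefschetzDegree' hf t D hK hKt (p := 2) (m := 0) (by omega) h2 fun ξ hξ hP hI ↦ ?_)
  obtain ⟨x, hx, hxe⟩ := hA3 ξ hξ hP hI
  refine ⟨x, hx, ?_⟩
  rw [lefschetzPowTo_zero_apply]
  exact hxe

/-- **`(W_E)₃ ∧ [at the `E`-power points of the compact sextic pencils: rank-one `H⁴`-invariants, and the Gysin images in the sevenfold of the
`κ`-PRIMITIVE invariant algebraic 3-cycle classes of `X_t ≅ E⁶` are `K ∪ (algebraic)`] ⟹ WeilSixfolds`** — the Weil-sixfold item of route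
`SevenfoldWeilCensus` from the sharpest fibre-supported clause (through parts XXIII-d's conversion and XXI-b §7 / XIX-f). `HC_CM` IDLE; no named
fact; `(W_E)₃` is an OPEN habitat node. research route, not a corollary; conditional on HC_CM plus one named minimal statement.
[cite: Grothendieck1968, §3 p. 196 (A(X))] [cite: Andre1996Motifs, Lemme 6.3.3 (p. 33)] [cite: vanGeemen1994HodgeAV, Thm. 4.3, 5.12 and 6.12] -/
theorem weilSixfolds_of_cmPowerWeilPencilsAt_of_rankOne_of_fibreLefschetzDegree_three (hW : CMPowerAnchoredCompactWeilPencilsAt 3)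
    (h : ∀ ⦃𝒳 S : SchemeOver ℂ⦄ (f : 𝒳 ⟶ S) (hf : IsCompactAbelianPencil f 6) (t : ComplexPoints S), t ∈ cmPowerLocus f 6 →
      Module.finrank ℂ (LinearMap.range (complexBetti.map (fiberι f t) (2 * 2)).hom) = 1 ∧
      ∀ D : KaehlerRationalDatum (6 + 1) 𝒳,
        (∀ s : ComplexPoints S, IsPolarizationClass 6 (fiberOver f s) (complexBetti.map (fiberι f s) 2 D.Hη)) →
        ∀ ξ ∈ algebraicClasses (fiberOver f t) 3,
          ξ ∈ primitiveClasses (complexBetti.map (fiberι f t) 2 D.Hη) 6 (2 * 3) →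
          ξ ∈ LinearMap.range (complexBetti.map (fiberι f t) (2 * 3)).hom →
          ∃ x ∈ algebraicClasses 𝒳 3, lefschetzPowTo D.Hη 1 (2 * 3) (2 * 4) (by omega) x = fiberGysin hf t 3 ξ) :
    Theses.SevenfoldWeilCensus.WeilSixfolds := by
  refine weilSixfolds_of_cmPowerWeilPencilsAt_of_primitiveLiftE hW ?_
  intro 𝒳 S f hf t ht K hKalg hKs r h2r hrd ξ hξ hP hI
  obtain ⟨h1, hA⟩ := h f hf t ht
  obtain ⟨D, hD⟩ := exists_kaehlerRationalDatum_polarization_fibres hf (by omega)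
  have hlift := forall_comap_le_sup_of_rankOne_of_fibreLefschetzDegree_three hf t D (fun s ↦ (hD s).hasHardLefschetz) (hD t) h1
    (hA D hD)
  exact (forall_comap_le_sup_iff_primitiveLift hf t hKalg hKs).1 hlift r h2r hrd ξ hξ hP hI

/-- **ON-PATH (per pencil): the Hodge conjecture for the TOTAL SPACE gives the fibre-supported clause** (indeed all of `A(𝒳, K)`, the tree's
`standardConjectureA_of_hodgeConjectureFor`); recorded so that the clause is visibly an upper hypothesis between `A_{p+1}(𝒳, K)` and the lift.
[cite: Grothendieck1968, §3 p. 196 (A(X))] -/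
theorem fibreLefschetzDegree_of_hodgeConjectureFor (hf : IsCompactAbelianPencil f d) (t : ComplexPoints S)
    (D : KaehlerRationalDatum (d + 1) 𝒳) (hHC : HodgeConjectureFor (d + 1) 𝒳) {p m : ℕ} (hpm : 2 * (p + 1) + m = d) :
    ∀ ξ ∈ algebraicClasses (fiberOver f t) (p + 1),
      ξ ∈ primitiveClasses (complexBetti.map (fiberι f t) 2 D.Hη) d (2 * (p + 1)) →
      ξ ∈ LinearMap.range (complexBetti.map (fiberι f t) (2 * (p + 1))).hom →
      ∃ x ∈ algebraicClasses 𝒳 (p + 1),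
        lefschetzPowTo D.Hη (m + 1) (2 * (p + 1)) (2 * (p + 1 + m + 1)) (by omega) x =
          fiberGysin hf t (p + 1 + m)
            (lefschetzPowTo (complexBetti.map (fiberι f t) 2 D.Hη) m (2 * (p + 1)) (2 * (p + 1 + m)) (by omega) ξ) := by
  intro ξ hξ _ _
  have h𝒳 := hf.isSmoothProjective_total
  have hA := standardConjectureA_of_hodgeConjectureFor h𝒳 (isPolarizationClass_Hη h𝒳 D) hHC
  have hy : fiberGysin hf t (p + 1 + m)
      (lefschetzPowTo (complexBetti.map (fiberι f t) 2 D.Hη) m (2 * (p + 1)) (2 * (p + 1 + m)) (by omega) ξ) ∈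
        algebraicClasses 𝒳 (p + 1 + m + 1) :=
    fiberGysin_mem_algebraicClasses hf t (lefschetzPowTo_mem_algebraicClasses (hf.isSmoothProjective_fiberOver t)
      ((isPolarizationClass_Hη h𝒳 D).mem_algebraicClasses |> fun h ↦ algebraicClasses_sup_ker_le_comap hf 1 t
        (Submodule.mem_sup_left h)) hξ m (p + 1 + m) rfl _)
  have key : ∀ {m' : ℕ} (hm' : 2 * (p + 1) + 2 * (m + 1) = m') {y : complexBetti 𝒳 m'},
      y ∈ supportedClasses 𝒳 m' (p + 1 + m + 1) →
        ∃ x ∈ algebraicClasses 𝒳 (p + 1), lefschetzPowTo D.Hη (m + 1) (2 * (p + 1)) m' hm' x = y := by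
    intro m' hm' y hy'
    subst hm'
    exact hA.exists_eq_lefschetzPow (by omega) (by omega) hy'
  exact key _ hy

end Rows

end Summit.HodgeConjecture.HodgeConjecture.Ring2.AbelianAll

end
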